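import Mathlib
import HarnessLib
import Literature.Probability.MarkovChains.PseudoMarginal

/-!
# Pseudo-marginal versus marginal Metropolis–Hastings: the acceptance-rate order

HONEST FRAMING: exact (Metropolis-corrected) sampling algorithms for lattice gauge theory;
figures of merit are autocorrelation/cost numbers at stated couplings and volumes; no
continuum-physics claim.

Setting (finite form, the vocabulary of `PseudoMarginal.lean`).  `X` is a finite state space with
a positive target weight `π`, `T : X → X → ℝ` a proposal matrix, `Ξ` a finite noise space with
law `g` (`Σ g = 1`), and `f : X → Ξ → ℝ`, positive, an UNBIASED estimator of the target,
`Σ_ξ g ξ · f x ξ = π x`.  In the notation of Andrieu–Vihola the NORMALISED estimator is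
`w = f x ξ / π x` ("`ϖ(x) := π̂(x)/π(x)` … a multiplicative perturbation, or noise, of the true
density"), its law `Q_x` is the `g`-pushforward, `∫ w Q_x(dw) = 1` is unbiasedness, the
pseudo-marginal chain `P̃` is the Metropolis–Hastings chain on `X × Ξ` for the extended weight
`π̃ = g ξ · f x ξ` (`PseudoMarginal.kernel`), and the MARGINAL algorithm `P` is the (in practice
unavailable) Metropolis–Hastings chain for `π` itself with the same `T`
[cite: AndrieuVihola2016, §1 (the abstract model `π̃(dx × dw) := π(dx) Q_x(dw) w` and the kernel
`P̃`)]; [cite: AndrieuVihola2015, §1 (the pseudo-marginal algorithm, `ρ̃(x,w)`)].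

The printed results formalised here (finite sums; every proof is the printed one):

* `PseudoMarginal.flow_le` — [cite: AndrieuVihola2015, §2 Lemma 1]:
  `∬ Q_x(dw) w Q_y(du) min{1, r(x,y) u/w} ≤ min{1, r(x,y)}` ("`t ↦ min{1,t}` is a concave
  function … Jensen's inequality, with the probability measure `Q_x(dw) w Q_y(du)`"), stated for
  the stationary `x → y` FLOW `Σ_{ξ,ξ'} π̃(x,ξ) P̃((x,ξ),(y,ξ')) = Σ g ξ g ξ' min(f x ξ T x y, f y ξ' T y x)`
  against the marginal flow `min(π x T x y, π y T y x) = π x · mhRate T π x y`.  The same order is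
  [cite: AndrieuVihola2016, Theorem 10 (a) with Remark 14 (the marginal algorithm is the case
  `Q_x ≡ δ_1`, "the unique minimal distribution in the convex order")].
* `PseudoMarginal.min_mul_noiseAccept_le_flow` — the first display of the second half of the
  proof of [cite: AndrieuVihola2015, §2 Proposition 2] ("`min{1, r u/w} ≥ min{1, r} min{1, u/w}`"),
  equivalently the factor form `α_{Q*} = α_EX · α_Z ≤ α_Q` of
  [cite: DoucetEtAl2015, §3.1 eqs. (Q*), (α_{Q*}) ("the acceptance probability (α_{Q*}) is always
  smaller than (α_Q)")]: `min(π x T x y, π y T y x) · N(x,y) ≤ flow`, with the NOISE ACCEPTANCE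
  `N(x,y) = Σ g ξ g ξ' min(w, u) = E min(W_x, U_y)` (`PseudoMarginal.noiseAccept`; Doucet et al.'s
  `π_Z(ρ_Z)` when the weight law does not depend on the state).
* `PseudoMarginal.two_mul_noiseAccept`, `PseudoMarginal.one_sub_noiseAccept_le` — the two
  elementary steps "`2 min{u,w} = u + w − |u − w|`" and "`|u − w| ≤ |1 − u| + |1 − w|`" of that proof:
  `N(x,y) = 1 − ½ E|W_x − U_y| ≥ 1 − ½ (E|W_x − 1| + E|U_y − 1|)`.
* `PseudoMarginal.pmAccept_le_mhAccept`, `PseudoMarginal.mhAccept_sub_pmAccept_le`,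
  `PseudoMarginal.mhAccept_sub_pmAccept_le'` — [cite: AndrieuVihola2015, §2 Corollary 4]: with the
  stationary expected acceptance rates `α_P := ∫ π(dx) ∫ q(x,dy) min{1, r(x,y)}` and
  `α_P̃ := ∫ π̃(dx,dw) ∫ q(x,dy) Q_y(du) min{1, r(x,y) u/w}` (both are the functional `mhAccept`
  below, applied to `(T, π)` and to the extended chain),
  `0 ≤ α_P − α_P̃ ≤ ∫ |w − 1| π(dx) (1 − ρ(x)) Q_x(dw) ≤ ∫ |w − 1| π(dx) Q_x(dw)`.
* `mhAccept_perfectProposal`, `PseudoMarginal.pmAccept_perfectProposal`,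
  `PseudoMarginal.pmAccept_perfectProposal_lt_one` — the "perfect" independent proposal
  `q(x, dy) = π(dy)` of [cite: AndrieuVihola2016, Example 13]: the marginal algorithm accepts with
  probability `1`, the pseudo-marginal one with probability `E N(x,y) < 1` as soon as one estimate is
  not exact — the sentence of [cite: AlbergoEtAl2021Fermions, §V ("the variance of the noisy
  estimates of each determinant would degrade the statistical performance achieved by even an
  optimally trained model … there is no non-trivial upper bound on the acceptance rate of the other
  three sampling approaches, and they will achieve an acceptance rate of 100% when perfect model
  distributions are constructed")] for the pseudo-marginal fermion-determinant route.

Also here (appended 2026-08-21, § `ConvexOrder`): [cite: AndrieuVihola2016, Theorem 10 (a)] in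
finite form — `IsCxLE` (Definition 3), `flow_mono_of_isCxLE` / `pmAccept_mono_of_isCxLE` (convex
order of the normalised weights ⇒ order of the acceptance flows / rates), `isCxLE_exact` (`δ_1` is
minimal: Remark 14 / Theorem 37), `flow_exact`, `flow_le_of_isCxLE` (Lemma 1 as the extreme case);
and § `Averaging`: [cite: AndrieuVihola2016, §6.1 Theorem 31] for independent draws — `piLaw`,
`avgEst` (the `N_pf`-draw averaged weight `w_{N_pf}` of [cite: AbbottEtAl2022Fermions, §III.E]),
`isCxLE_avg_succ` (one more draw ⇒ smaller in the convex order, by the leave-one-out symmetrisation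
and Jensen), `pmAccept_avgEst_mono` (every extra draw raises the stationary acceptance rate).

Deliberately NOT here — SEQUELS (2026-08-22): the asymptotic-variance order
[cite: AndrieuVihola2015, Theorem 7] (`PseudoMarginal.asympVar_le_asympVar_lift`) and item (b) of
[cite: AndrieuVihola2016, Theorem 10] (Dirichlet forms) are `PseudoMarginalVariance.lean`; item (c)
(asymptotic variances, under a martingale coupling of the two weight laws) with the averaging
corollary "every extra draw lowers the asymptotic variance" is `PseudoMarginalVarianceOrder.lean`;
the bounded-weight converse `var(g, P̃) ≤ w̄ var(g, P) + (w̄ − 1) var_π(g)`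
[cite: AndrieuVihola2015, Corollary 11] is `PseudoMarginalVarianceBound.lean`.  Still not in the
tree: items (d)–(e) (spectral gaps), Strassen's coupling theorem, general state spaces
(TODO(general form), as in `PseudoMarginal.lean`).  The Gaussian-noise VALUE of the
noise acceptance, `2Φ(−σ/√2)` [cite: DoucetEtAl2015, Corollary 3], is the companion file
`Literature/Probability/Distributions/PseudoMarginalGaussianNoise.lean`.

Context: cell pub-lqcd (venture LatticeQCDFlow), R2-SCOPE.md §3 E2 route D2 ("its acceptance is
bounded by the estimator's noise"), §4 cost class C-PM.
-/

namespace Literature.Probability.MarkovChains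

open Finset

variable {X : Type*} [Fintype X]

/-! ## The stationary expected acceptance rate of a Metropolis–Hastings chain -/

/-- The expected acceptance rate AT STATIONARITY of the Metropolis–Hastings chain with proposal
matrix `T` and (un-normalised) weight `π`:
`α_P = ∫ π(dx) ∫ q(x,dy) min{1, r(x,y)} = (Σ_x Σ_y π x · mhRate T π x y) / Σ_x π x`
(a proposal `y = x`, for which `r = 1`, counts as accepted, as in the printed integral).
[cite: AndrieuVihola2015, §2 Corollary 4 (definition of `α_P`, `α_P̃`)];
[cite: AndrieuVihola2016, §1 (the display defining `α(P̃)`)] -/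
noncomputable def mhAccept (T : X → X → ℝ) (π : X → ℝ) : ℝ :=
  (∑ x, ∑ y, π x * mhRate T π x y) / ∑ x, π x

omit [Fintype X] in
/-- The stationary `x → y` flow of a Metropolis–Hastings chain is the symmetric quantity
`π x · mhRate T π x y = min (π x T x y) (π y T y x)` (the tree's `mul_mhRate`, restated).
[cite: AndrieuVihola2015, §2 (proof of Proposition 2, last display:
"`π(dx) q(x,dy) min{1,r(x,y)} = π(dy) q(y,dx) min{1,r(y,x)}`")] -/
theorem mul_mhRate_comm {π : X → ℝ} (hπ : ∀ x, 0 < π x) (T : X → X → ℝ) (x y : X) :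
    π x * mhRate T π x y = π y * mhRate T π y x := by
  rw [mul_mhRate hπ, mul_mhRate hπ, min_comm]

/-- `α_P` written with the symmetric flows: `α_P = Σ_{x,y} min(π x T x y, π y T y x) / Σ π`.
[cite: AndrieuVihola2015, §2 Corollary 4] -/
theorem mhAccept_eq {π : X → ℝ} (hπ : ∀ x, 0 < π x) (T : X → X → ℝ) :
    mhAccept T π = (∑ x, ∑ y, min (π x * T x y) (π y * T y x)) / ∑ x, π x := by
  unfold mhAccept
  congr 1
  exact sum_congr rfl fun x _ => sum_congr rfl fun y _ => mul_mhRate hπ T x y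

/-- `0 ≤ α_P` for a non-negative proposal matrix and a positive weight.
[cite: AndrieuVihola2015, §2 Corollary 4 (`α_P` is a probability)] -/
theorem mhAccept_nonneg {π : X → ℝ} (hπ : ∀ x, 0 < π x) {T : X → X → ℝ} (hT : ∀ x y, 0 ≤ T x y) :
    0 ≤ mhAccept T π :=
  div_nonneg (sum_nonneg fun x _ => sum_nonneg fun y _ =>
    mul_nonneg (hπ x).le (mhRate_nonneg hT hπ x y)) (sum_nonneg fun x _ => (hπ x).le)

/-- `α_P ≤ 1` when the proposal matrix has row sums at most `1`.
[cite: AndrieuVihola2015, §2 Corollary 4 (`α_P` is a probability)] -/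
theorem mhAccept_le_one [Nonempty X] {π : X → ℝ} (hπ : ∀ x, 0 < π x) {T : X → X → ℝ}
    (hTrow : ∀ x, ∑ y, T x y ≤ 1) : mhAccept T π ≤ 1 := by
  have hZ : 0 < ∑ x, π x := sum_pos (fun x _ => hπ x) univ_nonempty
  unfold mhAccept
  rw [div_le_one hZ]
  refine sum_le_sum fun x _ => ?_
  calc ∑ y, π x * mhRate T π x y ≤ ∑ y, π x * T x y :=
        sum_le_sum fun y _ => mul_le_mul_of_nonneg_left (mhRate_le T π x y) (hπ x).le
    _ = π x * ∑ y, T x y := by rw [mul_sum]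
    _ ≤ π x := mul_le_of_le_one_right (hπ x).le (hTrow x)

/-! ## The "perfect" independent proposal `q(x, dy) = π(dy)` -/

/-- The perfect independent Metropolis–Hastings proposal: propose from the (normalised) target
itself, `T x y = π y / Σ π`, "a 'perfect' independent Metropolis-Hastings (IMH) algorithm, that is,
`q(x, dy) = π(dy)`". [cite: AndrieuVihola2016, Example 13] -/
noncomputable def perfectProposal (π : X → ℝ) : X → X → ℝ := fun _ y => π y / ∑ x, π x

/-- With the perfect proposal every move is accepted: `mhRate T π x y = T x y` (the Hastings ratio is
identically `1`). [cite: AndrieuVihola2016, Example 13]; [cite: DoucetEtAl2015, §3.3 Remark 2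
("the proposal is the target density: `q(θ, ϑ) = π(ϑ)` … `ϱ_EX(θ) = 1`")] -/
theorem mhRate_perfectProposal {π : X → ℝ} (hπ : ∀ x, 0 < π x) (x y : X) :
    mhRate (perfectProposal π) π x y = perfectProposal π x y := by
  have hZ : (∑ z, π z) ≠ 0 := (sum_pos (fun z _ => hπ z) ⟨x, mem_univ x⟩).ne'
  have hx : π x ≠ 0 := (hπ x).ne'
  unfold mhRate perfectProposal
  rw [show π y * (π x / ∑ z, π z) / π x = π y / ∑ z, π z by field_simp, min_self]

/-- The perfect proposal is a probability vector in each row. [cite: AndrieuVihola2016, Example 13] -/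
theorem sum_perfectProposal {π : X → ℝ} (hπ : ∀ x, 0 < π x) (x : X) :
    ∑ y, perfectProposal π x y = 1 := by
  have hZ : (∑ z, π z) ≠ 0 := (sum_pos (fun z _ => hπ z) ⟨x, mem_univ x⟩).ne'
  unfold perfectProposal
  rw [← sum_div, div_self hZ]

/-- The marginal algorithm with the perfect proposal has acceptance rate `α_P = 1`.
[cite: AndrieuVihola2016, Example 13]; [cite: DoucetEtAl2015, §3.3 Remark 2 (`ϱ_EX(θ) = 1`)];
[cite: AlbergoEtAl2021Fermions, §V ("an acceptance rate of 100% when perfect model distributions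
are constructed")] -/
theorem mhAccept_perfectProposal [Nonempty X] {π : X → ℝ} (hπ : ∀ x, 0 < π x) :
    mhAccept (perfectProposal π) π = 1 := by
  have hZ : 0 < ∑ x, π x := sum_pos (fun x _ => hπ x) univ_nonempty
  unfold mhAccept
  simp_rw [mhRate_perfectProposal hπ, ← mul_sum, sum_perfectProposal hπ, mul_one]
  exact div_self hZ.ne'

namespace PseudoMarginal

variable {Ξ : Type*} [Fintype Ξ]

/-! ## The stationary flow of the pseudo-marginal chain -/

/-- The stationary `x → y` acceptance FLOW of the pseudo-marginal chain: the extended weight of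
`(x, ξ)` times the Hastings rate `(x, ξ) → (y, ξ')`, summed over the recycled noise `ξ` and the
fresh noise `ξ'` — the integrand of `α_P̃ = ∫ π̃(dx,dw) ∫ q(x,dy) Q_y(du) min{1, r(x,y) u/w}` at fixed
`(x, y)`, times `Σ π`. [cite: AndrieuVihola2015, §2 Corollary 4 (definition of `α_P̃`)];
[cite: AndrieuVihola2016, §1 (`α_xy(P̃) := ∫ min{1, r(x,y) u/w} Q_x(dw) w Q_y(du)`)] -/
noncomputable def flow (T : X → X → ℝ) (f : X → Ξ → ℝ) (g : Ξ → ℝ) (x y : X) : ℝ :=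
  ∑ ξ, ∑ ξ', target f g (x, ξ) * mhRate (proposal T g) (target f g) (x, ξ) (y, ξ')

omit [Fintype X] [Fintype Ξ] in
/-- One term of the flow: `π̃(x,ξ) · rate((x,ξ) → (y,ξ')) = g ξ g ξ' · min(f x ξ T x y, f y ξ' T y x)`
(the extended chain's symmetric flow, by `mul_mhRate` on `X × Ξ`).
[cite: AndrieuVihola2016, §1 (the kernel `P̃(x,w; dy × du) = q(x,dy) Q_y(du) min{1, r(x,y) u/w}`)] -/
theorem target_mul_mhRate {f : X → Ξ → ℝ} {g : Ξ → ℝ} (hf : ∀ x ξ, 0 < f x ξ) (hg : ∀ ξ, 0 < g ξ)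
    (T : X → X → ℝ) (x y : X) (ξ ξ' : Ξ) :
    target f g (x, ξ) * mhRate (proposal T g) (target f g) (x, ξ) (y, ξ') =
      g ξ * g ξ' * min (f x ξ * T x y) (f y ξ' * T y x) := by
  have hpos : ∀ z : X × Ξ, 0 < target f g z := fun z => mul_pos (hg z.2) (hf z.1 z.2)
  rw [mul_mhRate hpos, mul_min_of_nonneg _ _ (mul_nonneg (hg ξ).le (hg ξ').le)]
  show min (g ξ * f x ξ * (T x y * g ξ')) (g ξ' * f y ξ' * (T y x * g ξ)) = _
  congr 1 <;> ring

omit [Fintype X] in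
/-- The flow in closed form: `flow T f g x y = Σ_{ξ,ξ'} g ξ g ξ' min(f x ξ T x y, f y ξ' T y x)` — with
`w = f x ξ/π x`, `u = f y ξ'/π y` this is `π x T x y · ∫ Q_x(dw) w Q_y(du) min{1, r(x,y) u/w}`.
[cite: AndrieuVihola2015, §2 Lemma 1 (the integrand)]; [cite: AndrieuVihola2016, §1 (`α_xy(P̃)`)] -/
theorem flow_eq {f : X → Ξ → ℝ} {g : Ξ → ℝ} (hf : ∀ x ξ, 0 < f x ξ) (hg : ∀ ξ, 0 < g ξ)
    (T : X → X → ℝ) (x y : X) :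
    flow T f g x y = ∑ ξ, ∑ ξ', g ξ * g ξ' * min (f x ξ * T x y) (f y ξ' * T y x) :=
  sum_congr rfl fun ξ _ => sum_congr rfl fun ξ' _ => target_mul_mhRate hf hg T x y ξ ξ'

omit [Fintype X] in
/-- The flow is symmetric in `x, y` (detailed balance of the extended chain, summed over the noise).
[cite: AndrieuVihola2015, §1 ("As a particular instance of the Metropolis-Hastings algorithm")] -/
theorem flow_comm {f : X → Ξ → ℝ} {g : Ξ → ℝ} (hf : ∀ x ξ, 0 < f x ξ) (hg : ∀ ξ, 0 < g ξ)
    (T : X → X → ℝ) (x y : X) : flow T f g x y = flow T f g y x := by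
  rw [flow_eq hf hg, flow_eq hf hg, sum_comm]
  exact sum_congr rfl fun a _ => sum_congr rfl fun b _ => by rw [mul_comm (g b) (g a), min_comm]

/-- The numerator of `α_P̃`: summing the extended chain's stationary flow over the whole extended
space is summing `flow` over pairs of states. [cite: AndrieuVihola2015, §2 Corollary 4 (`α_P̃`)] -/
theorem sum_target_mul_mhRate (T : X → X → ℝ) (f : X → Ξ → ℝ) (g : Ξ → ℝ) :
    ∑ z : X × Ξ, ∑ z' : X × Ξ, target f g z * mhRate (proposal T g) (target f g) z z' =
      ∑ x, ∑ y, flow T f g x y := by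
  rw [Fintype.sum_prod_type]
  refine sum_congr rfl fun x _ => ?_
  simp_rw [Fintype.sum_prod_type]
  rw [sum_comm]
  rfl

/-- **The pseudo-marginal acceptance rate** `α_P̃` is the Metropolis–Hastings acceptance functional
of the extended chain, and equals `(Σ_{x,y} flow x y) / Σ π` under unbiasedness.
[cite: AndrieuVihola2015, §2 Corollary 4 (definition of `α_P̃`)] -/
theorem pmAccept_eq {f : X → Ξ → ℝ} {g : Ξ → ℝ} {π : X → ℝ}
    (hunb : ∀ x, ∑ ξ, g ξ * f x ξ = π x) (T : X → X → ℝ) :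
    mhAccept (proposal T g) (target f g) = (∑ x, ∑ y, flow T f g x y) / ∑ x, π x := by
  unfold mhAccept
  rw [sum_target_mul_mhRate, sum_target_univ hunb]

/-! ## Lemma 1: Jensen — the pseudo-marginal flow is dominated by the marginal flow -/

/-- A double `g ⊗ g`-average of a quantity not depending on the second variable (private helper).
[folklore] -/
private theorem sum_sum_mul_left {g : Ξ → ℝ} (hg1 : ∑ ξ, g ξ = 1) (a : Ξ → ℝ) :
    ∑ ξ, ∑ ξ', g ξ * g ξ' * a ξ = ∑ ξ, g ξ * a ξ := by
  refine sum_congr rfl fun ξ _ => ?_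
  have : ∀ ξ', g ξ * g ξ' * a ξ = g ξ * a ξ * g ξ' := fun ξ' => by ring
  simp_rw [this, ← mul_sum, hg1, mul_one]

/-- A double `g ⊗ g`-average of a quantity not depending on the first variable (private helper).
[folklore] -/
private theorem sum_sum_mul_right {g : Ξ → ℝ} (hg1 : ∑ ξ, g ξ = 1) (b : Ξ → ℝ) :
    ∑ ξ, ∑ ξ', g ξ * g ξ' * b ξ' = ∑ ξ', g ξ' * b ξ' := by
  rw [sum_comm]
  refine sum_congr rfl fun ξ' _ => ?_
  have : ∀ ξ, g ξ * g ξ' * b ξ' = g ξ' * b ξ' * g ξ := fun ξ => by ring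
  simp_rw [this, ← mul_sum, hg1, mul_one]

/-- A sum of two double sums is the double sum of the sums (private helper). [folklore] -/
private theorem sum_sum_add_distrib (a b : Ξ → Ξ → ℝ) :
    ∑ ξ, ∑ ξ', (a ξ ξ' + b ξ ξ') = ∑ ξ, ∑ ξ', a ξ ξ' + ∑ ξ, ∑ ξ', b ξ ξ' := by
  rw [← sum_add_distrib]
  exact sum_congr rfl fun ξ _ => sum_add_distrib

omit [Fintype X] in
/-- **Andrieu–Vihola's Lemma 1** (finite form): for every pair of states,
`flow T f g x y ≤ min (π x T x y) (π y T y x)`, i.e.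
`∬ Q_x(dw) w Q_y(du) min{1, r(x,y) u/w} ≤ min{1, r(x,y)}` after division by `π x T x y` — "Notice that
`t ↦ min{1,t}` is a concave function. Therefore, one can apply Jensen's inequality, with the
probability measure `Q_x(dw) w Q_y(du)`" (here: a sum of minima is at most the minimum of the sums,
and the two sums are `π x T x y`, `π y T y x` by unbiasedness).
[cite: AndrieuVihola2015, §2 Lemma 1]; [cite: AndrieuVihola2016, Theorem 10 (a) with Remark 14] -/
theorem flow_le {f : X → Ξ → ℝ} {g : Ξ → ℝ} {π : X → ℝ} (hf : ∀ x ξ, 0 < f x ξ)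
    (hg : ∀ ξ, 0 < g ξ) (hg1 : ∑ ξ, g ξ = 1) (hunb : ∀ x, ∑ ξ, g ξ * f x ξ = π x)
    (T : X → X → ℝ) (x y : X) :
    flow T f g x y ≤ min (π x * T x y) (π y * T y x) := by
  rw [flow_eq hf hg]
  have hgg : ∀ ξ ξ', 0 ≤ g ξ * g ξ' := fun ξ ξ' => mul_nonneg (hg ξ).le (hg ξ').le
  refine le_min ?_ ?_
  · calc ∑ ξ, ∑ ξ', g ξ * g ξ' * min (f x ξ * T x y) (f y ξ' * T y x)
          ≤ ∑ ξ, ∑ ξ', g ξ * g ξ' * (f x ξ * T x y) :=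
            sum_le_sum fun ξ _ => sum_le_sum fun ξ' _ =>
              mul_le_mul_of_nonneg_left (min_le_left _ _) (hgg ξ ξ')
      _ = ∑ ξ, g ξ * (f x ξ * T x y) := sum_sum_mul_left hg1 (fun ξ => f x ξ * T x y)
      _ = π x * T x y := by
            rw [← hunb x, sum_mul]
            exact sum_congr rfl fun ξ _ => by ring
  · calc ∑ ξ, ∑ ξ', g ξ * g ξ' * min (f x ξ * T x y) (f y ξ' * T y x)
          ≤ ∑ ξ, ∑ ξ', g ξ * g ξ' * (f y ξ' * T y x) :=
            sum_le_sum fun ξ _ => sum_le_sum fun ξ' _ =>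
              mul_le_mul_of_nonneg_left (min_le_right _ _) (hgg ξ ξ')
      _ = ∑ ξ', g ξ' * (f y ξ' * T y x) := sum_sum_mul_right hg1 (fun ξ' => f y ξ' * T y x)
      _ = π y * T y x := by
            rw [← hunb y, sum_mul]
            exact sum_congr rfl fun ξ' _ => by ring

omit [Fintype X] in
/-- Lemma 1 against the marginal chain's flow `π x · mhRate T π x y`.
[cite: AndrieuVihola2015, §2 Lemma 1] -/
theorem flow_le_mul_mhRate {f : X → Ξ → ℝ} {g : Ξ → ℝ} {π : X → ℝ} (hf : ∀ x ξ, 0 < f x ξ)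
    (hg : ∀ ξ, 0 < g ξ) (hg1 : ∑ ξ, g ξ = 1) (hunb : ∀ x, ∑ ξ, g ξ * f x ξ = π x)
    (hπ : ∀ x, 0 < π x) (T : X → X → ℝ) (x y : X) :
    flow T f g x y ≤ π x * mhRate T π x y := by
  rw [mul_mhRate hπ]
  exact flow_le hf hg hg1 hunb T x y

/-! ## The noise acceptance and the factor lower bound -/

/-- The NOISE ACCEPTANCE between states `x` and `y`:
`N(x,y) = Σ_{ξ,ξ'} g ξ g ξ' min(f x ξ/π x, f y ξ'/π y) = E min(W_x, U_y)` for independent normalised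
weights `W_x ∼ Q_x`, `U_y ∼ Q_y` — equivalently `∫ Q_x(dw) w Q_y(du) min{1, u/w}`, the stationary
average of the noise-only acceptance `α_Z(z,w) = min{1, exp(w − z)}` of Doucet et al.
[cite: AndrieuVihola2015, §2 (proof of Proposition 2: the factor `min{1, u/w}` and
"`2 min{u,w} = u + w − |u − w|`")]; [cite: DoucetEtAl2015, §3.1 eq. (α_{Q*}) (`α_Z`, `ϱ_Z`) and
Corollary 3 (`π_Z(ϱ_Z)`)] -/
noncomputable def noiseAccept (f : X → Ξ → ℝ) (g : Ξ → ℝ) (π : X → ℝ) (x y : X) : ℝ :=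
  ∑ ξ, ∑ ξ', g ξ * g ξ' * min (f x ξ / π x) (f y ξ' / π y)

/-- The mean absolute deviation of the normalised weight at `x`:
`e(x) = ∫ |w − 1| Q_x(dw) = Σ_ξ g ξ |f x ξ/π x − 1|`. [cite: AndrieuVihola2015, §2 Corollary 4 (the
bound `∫ |w − 1| π(dx) Q_x(dw)`)] -/
noncomputable def weightMAD (f : X → Ξ → ℝ) (g : Ξ → ℝ) (π : X → ℝ) (x : X) : ℝ :=
  ∑ ξ, g ξ * |f x ξ / π x - 1|

/-- `min A B · min w u ≤ min (A w) (B u)` for non-negative reals (private helper). [folklore] -/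
private theorem min_mul_min_le {A B w u : ℝ} (hA : 0 ≤ A) (hB : 0 ≤ B) (hw : 0 ≤ w) (hu : 0 ≤ u) :
    min A B * min w u ≤ min (A * w) (B * u) :=
  le_min (mul_le_mul (min_le_left _ _) (min_le_left _ _) (le_min hw hu) hA)
    (mul_le_mul (min_le_right _ _) (min_le_right _ _) (le_min hw hu) hB)

omit [Fintype X] in
/-- **The factor lower bound**: `min(π x T x y, π y T y x) · N(x,y) ≤ flow T f g x y`, i.e.
`min{1, r} · ∫ Q_x(dw) w Q_y(du) min{1, u/w} ≤ ∫ Q_x(dw) w Q_y(du) min{1, r u/w}`, from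
"`min{1, r(x,y) u/w} ≥ min{1, r(x,y)} min{1, u/w}`" termwise.
[cite: AndrieuVihola2015, §2 Proposition 2 (proof, "For the second bound, note that …")];
[cite: DoucetEtAl2015, §3.1 ("the acceptance probability (α_{Q*}) is always smaller than (α_Q)")] -/
theorem min_mul_noiseAccept_le_flow {f : X → Ξ → ℝ} {g : Ξ → ℝ} {π : X → ℝ} (hf : ∀ x ξ, 0 < f x ξ)
    (hg : ∀ ξ, 0 < g ξ) (hπ : ∀ x, 0 < π x) {T : X → X → ℝ} (hT : ∀ x y, 0 ≤ T x y) (x y : X) :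
    min (π x * T x y) (π y * T y x) * noiseAccept f g π x y ≤ flow T f g x y := by
  rw [flow_eq hf hg, noiseAccept, mul_sum]
  refine sum_le_sum fun ξ _ => ?_
  rw [mul_sum]
  refine sum_le_sum fun ξ' _ => ?_
  have hgg : 0 ≤ g ξ * g ξ' := mul_nonneg (hg ξ).le (hg ξ').le
  have hx : π x ≠ 0 := (hπ x).ne'
  have hy : π y ≠ 0 := (hπ y).ne'
  calc min (π x * T x y) (π y * T y x) * (g ξ * g ξ' * min (f x ξ / π x) (f y ξ' / π y))
      = g ξ * g ξ' * (min (π x * T x y) (π y * T y x) * min (f x ξ / π x) (f y ξ' / π y)) := by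
        ring
    _ ≤ g ξ * g ξ' * min (π x * T x y * (f x ξ / π x)) (π y * T y x * (f y ξ' / π y)) :=
        mul_le_mul_of_nonneg_left (min_mul_min_le (mul_nonneg (hπ x).le (hT x y))
          (mul_nonneg (hπ y).le (hT y x)) (div_nonneg (hf x ξ).le (hπ x).le)
          (div_nonneg (hf y ξ').le (hπ y).le)) hgg
    _ = g ξ * g ξ' * min (f x ξ * T x y) (f y ξ' * T y x) := by
        rw [show π x * T x y * (f x ξ / π x) = f x ξ * T x y by field_simp,
          show π y * T y x * (f y ξ' / π y) = f y ξ' * T y x by field_simp]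

omit [Fintype X] in
/-- Unbiasedness in normalised form: `∫ w Q_x(dw) = Σ_ξ g ξ · (f x ξ / π x) = 1`.
[cite: AndrieuVihola2016, §1 ("such that `∫ w Q_x(dw) = 1` for any `x`")] -/
theorem sum_normWeight {f : X → Ξ → ℝ} {g : Ξ → ℝ} {π : X → ℝ}
    (hunb : ∀ x, ∑ ξ, g ξ * f x ξ = π x) (hπ : ∀ x, 0 < π x) (x : X) :
    ∑ ξ, g ξ * (f x ξ / π x) = 1 := by
  have hx : π x ≠ 0 := (hπ x).ne'
  simp_rw [mul_div_assoc', ← sum_div, hunb x, div_self hx]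

/-- `2 min(w, u) = w + u − |w − u|` (private helper). [folklore] -/
private theorem two_mul_min_eq (w u : ℝ) : 2 * min w u = w + u - |w - u| := by
  rcases le_total w u with h | h
  · rw [min_eq_left h, abs_of_nonpos (sub_nonpos.mpr h)]; ring
  · rw [min_eq_right h, abs_of_nonneg (sub_nonneg.mpr h)]; ring

omit [Fintype X] in
/-- **`2 min{u,w} = u + w − |u − w|`, averaged**: the noise acceptance is one minus half the mean
absolute difference of the two normalised weights,
`2 N(x,y) = 2 − Σ_{ξ,ξ'} g ξ g ξ' |f x ξ/π x − f y ξ'/π y|`.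
[cite: AndrieuVihola2015, §2 Proposition 2 (proof, "`2 min{u,w} = u + w − |u − w|`")] -/
theorem two_mul_noiseAccept {f : X → Ξ → ℝ} {g : Ξ → ℝ} {π : X → ℝ} (hg1 : ∑ ξ, g ξ = 1)
    (hunb : ∀ x, ∑ ξ, g ξ * f x ξ = π x) (hπ : ∀ x, 0 < π x) (x y : X) :
    2 * noiseAccept f g π x y =
      2 - ∑ ξ, ∑ ξ', g ξ * g ξ' * |f x ξ / π x - f y ξ' / π y| := by
  have hterm : ∀ ξ ξ', 2 * (g ξ * g ξ' * min (f x ξ / π x) (f y ξ' / π y)) =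
      (g ξ * g ξ' * (f x ξ / π x) + g ξ * g ξ' * (f y ξ' / π y)) -
        g ξ * g ξ' * |f x ξ / π x - f y ξ' / π y| := by
    intro ξ ξ'
    rw [mul_left_comm, two_mul_min_eq]
    ring
  unfold noiseAccept
  rw [mul_sum]
  simp_rw [mul_sum, hterm, sum_sub_distrib, sum_sum_add_distrib,
    sum_sum_mul_left hg1 (fun ξ => f x ξ / π x), sum_sum_mul_right hg1 (fun ξ' => f y ξ' / π y),
    sum_normWeight hunb hπ x, sum_normWeight hunb hπ y]
  ring

omit [Fintype X] in
/-- The noise acceptance is at most `1` (it is `E min(W,U) ≤ min(E W, E U) = 1`).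
[cite: AndrieuVihola2015, §2 Lemma 1 (the case `r = 1`)] -/
theorem noiseAccept_le_one {f : X → Ξ → ℝ} {g : Ξ → ℝ} {π : X → ℝ} (hg : ∀ ξ, 0 < g ξ)
    (hg1 : ∑ ξ, g ξ = 1) (hunb : ∀ x, ∑ ξ, g ξ * f x ξ = π x) (hπ : ∀ x, 0 < π x) (x y : X) :
    noiseAccept f g π x y ≤ 1 := by
  have h := two_mul_noiseAccept hg1 hunb hπ x y
  have hs : 0 ≤ ∑ ξ, ∑ ξ', g ξ * g ξ' * |f x ξ / π x - f y ξ' / π y| :=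
    sum_nonneg fun ξ _ => sum_nonneg fun ξ' _ =>
      mul_nonneg (mul_nonneg (hg ξ).le (hg ξ').le) (abs_nonneg _)
  linarith

omit [Fintype X] in
/-- The noise acceptance is non-negative (the weights live on the non-negative reals).
[cite: AndrieuVihola2016, §1 ("`{Q_x}` … a family of probability measures on the non-negative
reals")] -/
theorem noiseAccept_nonneg {f : X → Ξ → ℝ} {g : Ξ → ℝ} {π : X → ℝ} (hf : ∀ x ξ, 0 < f x ξ)
    (hg : ∀ ξ, 0 < g ξ) (hπ : ∀ x, 0 < π x) (x y : X) : 0 ≤ noiseAccept f g π x y :=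
  sum_nonneg fun ξ _ => sum_nonneg fun ξ' _ => mul_nonneg (mul_nonneg (hg ξ).le (hg ξ').le)
    (le_min (div_nonneg (hf x ξ).le (hπ x).le) (div_nonneg (hf y ξ').le (hπ y).le))

omit [Fintype X] in
/-- **`|u − w| ≤ |1 − u| + |1 − w|`, averaged**: the acceptance lost to the noise between `x` and `y`
is at most the mean of the two mean absolute deviations,
`1 − N(x,y) ≤ (e(x) + e(y)) / 2`.
[cite: AndrieuVihola2015, §2 Proposition 2 (proof, "the last inequality follows by the bound
`|u − w| ≤ |1 − u| + |1 − w|`") and Remark 3] -/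
theorem one_sub_noiseAccept_le {f : X → Ξ → ℝ} {g : Ξ → ℝ} {π : X → ℝ} (hg : ∀ ξ, 0 < g ξ)
    (hg1 : ∑ ξ, g ξ = 1) (hunb : ∀ x, ∑ ξ, g ξ * f x ξ = π x) (hπ : ∀ x, 0 < π x) (x y : X) :
    1 - noiseAccept f g π x y ≤ (weightMAD f g π x + weightMAD f g π y) / 2 := by
  have h := two_mul_noiseAccept hg1 hunb hπ x y
  have hgg : ∀ ξ ξ', 0 ≤ g ξ * g ξ' := fun ξ ξ' => mul_nonneg (hg ξ).le (hg ξ').le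
  have hle : ∑ ξ, ∑ ξ', g ξ * g ξ' * |f x ξ / π x - f y ξ' / π y| ≤
      weightMAD f g π x + weightMAD f g π y := by
    calc ∑ ξ, ∑ ξ', g ξ * g ξ' * |f x ξ / π x - f y ξ' / π y|
        ≤ ∑ ξ, ∑ ξ', (g ξ * g ξ' * |f x ξ / π x - 1| + g ξ * g ξ' * |f y ξ' / π y - 1|) := by
          refine sum_le_sum fun ξ _ => sum_le_sum fun ξ' _ => ?_
          rw [← mul_add]
          refine mul_le_mul_of_nonneg_left ?_ (hgg ξ ξ')
          calc |f x ξ / π x - f y ξ' / π y| ≤ |f x ξ / π x - 1| + |1 - f y ξ' / π y| :=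
                abs_sub_le _ _ _
            _ = |f x ξ / π x - 1| + |f y ξ' / π y - 1| := by rw [abs_sub_comm 1]
      _ = weightMAD f g π x + weightMAD f g π y := by
          rw [sum_sum_add_distrib, sum_sum_mul_left hg1 (fun ξ => |f x ξ / π x - 1|),
            sum_sum_mul_right hg1 (fun ξ' => |f y ξ' / π y - 1|)]
          rfl
  linarith

omit [Fintype X] in
/-- **The noise costs acceptance as soon as it is there**: if the estimator at `x` is not exact
(`f x ξ ≠ π x` for some `ξ`), then `N(x,y) < 1` for EVERY `y` — whatever the quality of the
proposal. [cite: AlbergoEtAl2021Fermions, §V ("the variance of the noisy estimates … would degrade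
the statistical performance achieved by even an optimally trained model")];
[cite: AndrieuVihola2016, Remark 14 (`δ_1` "is the unique minimal distribution in the convex
order")] -/
theorem noiseAccept_lt_one {f : X → Ξ → ℝ} {g : Ξ → ℝ} {π : X → ℝ} (hg : ∀ ξ, 0 < g ξ)
    (hg1 : ∑ ξ, g ξ = 1) (hunb : ∀ x, ∑ ξ, g ξ * f x ξ = π x) (hπ : ∀ x, 0 < π x) {x : X} {ξ₀ : Ξ}
    (hne : f x ξ₀ ≠ π x) (y : X) : noiseAccept f g π x y < 1 := by
  have h := two_mul_noiseAccept hg1 hunb hπ x y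
  -- the recycled weight `f x ξ₀ / π x ≠ 1` cannot equal every fresh weight at `y` (they average to 1)
  have hw : f x ξ₀ / π x ≠ 1 := fun h1 => hne ((div_eq_one_iff_eq (hπ x).ne').mp h1)
  obtain ⟨ξ₁, hξ₁⟩ : ∃ ξ', f x ξ₀ / π x ≠ f y ξ' / π y := by
    by_contra hall
    push Not at hall
    have h1 : ∑ ξ', g ξ' * (f y ξ' / π y) = f x ξ₀ / π x := by
      rw [show ∑ ξ', g ξ' * (f y ξ' / π y) = ∑ ξ', g ξ' * (f x ξ₀ / π x) from
        sum_congr rfl fun ξ' _ => by rw [hall ξ'], ← sum_mul, hg1, one_mul]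
    rw [sum_normWeight hunb hπ y] at h1
    exact hw h1.symm
  have hgg : ∀ ξ ξ', 0 ≤ g ξ * g ξ' * |f x ξ / π x - f y ξ' / π y| := fun ξ ξ' =>
    mul_nonneg (mul_nonneg (hg ξ).le (hg ξ').le) (abs_nonneg _)
  have hpos : 0 < ∑ ξ, ∑ ξ', g ξ * g ξ' * |f x ξ / π x - f y ξ' / π y| := by
    calc (0 : ℝ) < g ξ₀ * g ξ₁ * |f x ξ₀ / π x - f y ξ₁ / π y| :=
          mul_pos (mul_pos (hg ξ₀) (hg ξ₁)) (abs_pos.mpr (sub_ne_zero.mpr hξ₁))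
      _ ≤ ∑ ξ', g ξ₀ * g ξ' * |f x ξ₀ / π x - f y ξ' / π y| :=
          single_le_sum (f := fun ξ' => g ξ₀ * g ξ' * |f x ξ₀ / π x - f y ξ' / π y|)
            (fun ξ' _ => hgg ξ₀ ξ') (mem_univ ξ₁)
      _ ≤ ∑ ξ, ∑ ξ', g ξ * g ξ' * |f x ξ / π x - f y ξ' / π y| :=
          single_le_sum (f := fun ξ => ∑ ξ', g ξ * g ξ' * |f x ξ / π x - f y ξ' / π y|)
            (fun ξ _ => sum_nonneg fun ξ' _ => hgg ξ ξ') (mem_univ ξ₀)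
  linarith

/-! ## Corollary 4: `0 ≤ α_P − α_P̃ ≤ ∫|w − 1| π(dx)(1 − ρ(x)) Q_x(dw) ≤ ∫|w − 1| π(dx) Q_x(dw)` -/

/-- **Pseudo-marginal acceptance ≤ marginal acceptance** (`0 ≤ α_P − α_P̃`): for every proposal
matrix `T`, the stationary expected acceptance rate of the pseudo-marginal chain is at most that of
the marginal chain it approximates. [cite: AndrieuVihola2015, §2 Corollary 4 (first inequality)];
[cite: AndrieuVihola2016, Theorem 10 (a) with Remark 14 ("the marginal algorithm, or equivalently,
… the degenerate case `Q_x^{(1)} ≡ δ_1`")] -/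
theorem pmAccept_le_mhAccept {f : X → Ξ → ℝ} {g : Ξ → ℝ} {π : X → ℝ} (hf : ∀ x ξ, 0 < f x ξ)
    (hg : ∀ ξ, 0 < g ξ) (hg1 : ∑ ξ, g ξ = 1) (hunb : ∀ x, ∑ ξ, g ξ * f x ξ = π x)
    (hπ : ∀ x, 0 < π x) (T : X → X → ℝ) :
    mhAccept (proposal T g) (target f g) ≤ mhAccept T π := by
  rw [pmAccept_eq hunb, mhAccept]
  exact div_le_div_of_nonneg_right (sum_le_sum fun x _ => sum_le_sum fun y _ =>
    flow_le_mul_mhRate hf hg hg1 hunb hπ T x y) (sum_nonneg fun x _ => (hπ x).le)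

/-- **Andrieu–Vihola's Corollary 4, middle inequality** (finite form):
`α_P − α_P̃ ≤ ∫ |w − 1| π(dx) (1 − ρ(x)) Q_x(dw)`, where `1 − ρ(x) = Σ_y mhRate T π x y` is the marginal
chain's acceptance probability from `x` and `∫|w − 1| Q_x(dw) = weightMAD f g π x`; with the
un-normalised `π` the right-hand side reads `(Σ_x π x · e(x) · Σ_y mhRate T π x y) / Σ π`.  Proof as
printed: the factor bound, `2 min{u,w} = u + w − |u − w|`, `|u − w| ≤ |1 − u| + |1 − w|`, and the
symmetry of `π(dx) q(x,dy) min{1, r(x,y)}` to merge the two halves.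
[cite: AndrieuVihola2015, §2 Proposition 2 (with `g ≡ 1`) and Corollary 4] -/
theorem mhAccept_sub_pmAccept_le {f : X → Ξ → ℝ} {g : Ξ → ℝ} {π : X → ℝ} (hf : ∀ x ξ, 0 < f x ξ)
    (hg : ∀ ξ, 0 < g ξ) (hg1 : ∑ ξ, g ξ = 1) (hunb : ∀ x, ∑ ξ, g ξ * f x ξ = π x)
    (hπ : ∀ x, 0 < π x) {T : X → X → ℝ} (hT : ∀ x y, 0 ≤ T x y) :
    mhAccept T π - mhAccept (proposal T g) (target f g) ≤
      (∑ x, π x * weightMAD f g π x * ∑ y, mhRate T π x y) / ∑ x, π x := by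
  have hZ : 0 ≤ ∑ x, π x := sum_nonneg fun x _ => (hπ x).le
  rw [pmAccept_eq hunb, mhAccept, ← sub_div]
  refine div_le_div_of_nonneg_right ?_ hZ
  have hEsymm : ∀ x y, π x * mhRate T π x y = π y * mhRate T π y x :=
    fun x y => mul_mhRate_comm hπ T x y
  -- termwise: `E − flow ≤ E (1 − N) ≤ E (e x + e y)/2`, with `E = π x · mhRate T π x y ≥ 0`
  have hterm : ∀ x y, π x * mhRate T π x y - flow T f g x y ≤
      π x * mhRate T π x y * ((weightMAD f g π x + weightMAD f g π y) / 2) := by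
    intro x y
    have hEnn : 0 ≤ π x * mhRate T π x y := mul_nonneg (hπ x).le (mhRate_nonneg hT hπ x y)
    have h1 : π x * mhRate T π x y * noiseAccept f g π x y ≤ flow T f g x y := by
      rw [mul_mhRate hπ]
      exact min_mul_noiseAccept_le_flow hf hg hπ hT x y
    have h3 := mul_le_mul_of_nonneg_left (one_sub_noiseAccept_le hg hg1 hunb hπ x y) hEnn
    rw [mul_sub, mul_one] at h3
    linarith
  calc ∑ x, ∑ y, π x * mhRate T π x y - ∑ x, ∑ y, flow T f g x y
      = ∑ x, ∑ y, (π x * mhRate T π x y - flow T f g x y) := by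
        simp_rw [sum_sub_distrib]
    _ ≤ ∑ x, ∑ y, π x * mhRate T π x y * ((weightMAD f g π x + weightMAD f g π y) / 2) :=
        sum_le_sum fun x _ => sum_le_sum fun y _ => hterm x y
    _ = (∑ x, ∑ y, π x * mhRate T π x y * weightMAD f g π x) / 2 +
          (∑ x, ∑ y, π x * mhRate T π x y * weightMAD f g π y) / 2 := by
        simp_rw [mul_div_assoc', mul_add, add_div, sum_add_distrib, sum_div]
    _ = ∑ x, ∑ y, π x * mhRate T π x y * weightMAD f g π x := by
        -- symmetry of the marginal flow: the second half equals the first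
        have : ∑ x, ∑ y, π x * mhRate T π x y * weightMAD f g π y =
            ∑ x, ∑ y, π x * mhRate T π x y * weightMAD f g π x := by
          rw [sum_comm]
          exact sum_congr rfl fun y _ => sum_congr rfl fun x _ => by rw [hEsymm]
        rw [this]
        ring
    _ = ∑ x, π x * weightMAD f g π x * ∑ y, mhRate T π x y := by
        refine sum_congr rfl fun x _ => ?_
        rw [mul_sum]
        exact sum_congr rfl fun y _ => by ring

/-- **Andrieu–Vihola's Corollary 4, last inequality** (finite form): for a proposal matrix with
row sums at most `1`, `α_P − α_P̃ ≤ ∫ |w − 1| π(dx) Q_x(dw) = (Σ_x π x · e(x)) / Σ π` — "The last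
inequality follows because `ρ(x) ∈ [0,1]`". [cite: AndrieuVihola2015, §2 Corollary 4] -/
theorem mhAccept_sub_pmAccept_le' {f : X → Ξ → ℝ} {g : Ξ → ℝ} {π : X → ℝ} (hf : ∀ x ξ, 0 < f x ξ)
    (hg : ∀ ξ, 0 < g ξ) (hg1 : ∑ ξ, g ξ = 1) (hunb : ∀ x, ∑ ξ, g ξ * f x ξ = π x)
    (hπ : ∀ x, 0 < π x) {T : X → X → ℝ} (hT : ∀ x y, 0 ≤ T x y) (hTrow : ∀ x, ∑ y, T x y ≤ 1) :
    mhAccept T π - mhAccept (proposal T g) (target f g) ≤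
      (∑ x, π x * weightMAD f g π x) / ∑ x, π x := by
  refine (mhAccept_sub_pmAccept_le hf hg hg1 hunb hπ hT).trans
    (div_le_div_of_nonneg_right (sum_le_sum fun x _ => ?_) (sum_nonneg fun x _ => (hπ x).le))
  have hpe : 0 ≤ π x * weightMAD f g π x :=
    mul_nonneg (hπ x).le (sum_nonneg fun ξ _ => mul_nonneg (hg ξ).le (abs_nonneg _))
  exact mul_le_of_le_one_right hpe ((sum_le_sum fun y _ => mhRate_le T π x y).trans (hTrow x))

/-! ## The perfect proposal: the pseudo-marginal ceiling `E N < 1` -/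

/-- With the perfect proposal the flow is `(π x π y / Σ π) · N(x,y)`: the Hastings ratio is `1` and only
the noise acceptance remains. [cite: AndrieuVihola2016, Example 13];
[cite: DoucetEtAl2015, §3.3 Remark 2 of arXiv:1210.1871 (perfect proposal: `α_Q = α_Z`)] -/
theorem flow_perfectProposal {f : X → Ξ → ℝ} {g : Ξ → ℝ} {π : X → ℝ}
    (hf : ∀ x ξ, 0 < f x ξ) (hg : ∀ ξ, 0 < g ξ) (hπ : ∀ x, 0 < π x) (x y : X) :
    flow (perfectProposal π) f g x y = π x * π y / (∑ z, π z) * noiseAccept f g π x y := by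
  have hZ : 0 < ∑ z, π z := sum_pos (fun z _ => hπ z) ⟨x, mem_univ x⟩
  have hx : π x ≠ 0 := (hπ x).ne'
  have hy : π y ≠ 0 := (hπ y).ne'
  have hZ' : (∑ z, π z) ≠ 0 := hZ.ne'
  rw [flow_eq hf hg, noiseAccept, mul_sum]
  refine sum_congr rfl fun ξ _ => ?_
  rw [mul_sum]
  refine sum_congr rfl fun ξ' _ => ?_
  have hc : 0 ≤ π x * π y / ∑ z, π z := div_nonneg (mul_nonneg (hπ x).le (hπ y).le) hZ.le
  calc g ξ * g ξ' * min (f x ξ * perfectProposal π x y) (f y ξ' * perfectProposal π y x)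
      = g ξ * g ξ' * min (π x * π y / (∑ z, π z) * (f x ξ / π x))
          (π x * π y / (∑ z, π z) * (f y ξ' / π y)) := by
        unfold perfectProposal
        rw [show f x ξ * (π y / ∑ z, π z) = π x * π y / (∑ z, π z) * (f x ξ / π x) by
            field_simp,
          show f y ξ' * (π x / ∑ z, π z) = π x * π y / (∑ z, π z) * (f y ξ' / π y) by
            field_simp]
    _ = π x * π y / (∑ z, π z) * (g ξ * g ξ' * min (f x ξ / π x) (f y ξ' / π y)) := by
        rw [← mul_min_of_nonneg _ _ hc]
        ring

/-- **The pseudo-marginal acceptance with a perfect proposal** is the `π ⊗ π`-average of the noise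
acceptance: `α_P̃ = Σ_{x,y} π x π y N(x,y) / (Σ π)²` (`= 2Φ(−σ/√2)` for state-independent Gaussian
log-noise, Doucet et al. Corollary 3). [cite: AndrieuVihola2016, Example 13];
[cite: DoucetEtAl2015, §3.3 Remark 2 and Corollary 3] -/
theorem pmAccept_perfectProposal {f : X → Ξ → ℝ} {g : Ξ → ℝ} {π : X → ℝ} (hf : ∀ x ξ, 0 < f x ξ)
    (hg : ∀ ξ, 0 < g ξ) (hunb : ∀ x, ∑ ξ, g ξ * f x ξ = π x) (hπ : ∀ x, 0 < π x) :
    mhAccept (proposal (perfectProposal π) g) (target f g) =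
      (∑ x, ∑ y, π x * π y * noiseAccept f g π x y) / (∑ x, π x) ^ 2 := by
  rw [pmAccept_eq hunb]
  simp_rw [flow_perfectProposal hf hg hπ, div_mul_eq_mul_div, ← sum_div]
  rw [div_div, sq]

/-- **The noise puts a non-trivial ceiling on the acceptance rate**: with the perfect proposal the
marginal algorithm accepts every move (`mhAccept_perfectProposal`), but the pseudo-marginal
algorithm has acceptance rate `< 1` as soon as ONE estimate is not exact — "If replaced with the
pseudo-marginal estimator …, the variance of the noisy estimates of each determinant would degrade
the statistical performance achieved by even an optimally trained model … there is no non-trivial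
upper bound on the acceptance rate of the other three sampling approaches".
[cite: AlbergoEtAl2021Fermions, §V]; [cite: AndrieuVihola2016, Example 13, Remark 14];
[cite: AndrieuVihola2015, §2 Corollary 4] -/
theorem pmAccept_perfectProposal_lt_one {f : X → Ξ → ℝ} {g : Ξ → ℝ} {π : X → ℝ}
    (hf : ∀ x ξ, 0 < f x ξ) (hg : ∀ ξ, 0 < g ξ) (hg1 : ∑ ξ, g ξ = 1)
    (hunb : ∀ x, ∑ ξ, g ξ * f x ξ = π x) (hπ : ∀ x, 0 < π x) {x₀ : X} {ξ₀ : Ξ}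
    (hne : f x₀ ξ₀ ≠ π x₀) :
    mhAccept (proposal (perfectProposal π) g) (target f g) < 1 := by
  have hZ : 0 < ∑ z, π z := sum_pos (fun z _ => hπ z) ⟨x₀, mem_univ x₀⟩
  rw [pmAccept_perfectProposal hf hg hunb hπ, div_lt_one (pow_pos hZ 2), sq, sum_mul_sum]
  have hle : ∀ x y, π x * π y * noiseAccept f g π x y ≤ π x * π y := fun x y =>
    mul_le_of_le_one_right (mul_nonneg (hπ x).le (hπ y).le) (noiseAccept_le_one hg hg1 hunb hπ x y)
  refine sum_lt_sum (fun x _ => sum_le_sum fun y _ => hle x y) ⟨x₀, mem_univ _, ?_⟩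
  refine sum_lt_sum (fun y _ => hle x₀ y) ⟨x₀, mem_univ _, ?_⟩
  exact mul_lt_of_lt_one_right (mul_pos (hπ x₀) (hπ x₀))
    (noiseAccept_lt_one hg hg1 hunb hπ hne x₀)

/-- **The two-sided sandwich at the perfect proposal**, packaged:
`1 − (Σ_x π x e(x)) / Σ π ≤ α_P̃ (≤ 1 = α_P)`. [cite: AndrieuVihola2015, §2 Corollary 4];
[cite: AndrieuVihola2016, Example 13] -/
theorem pmAccept_perfectProposal_ge [Nonempty X] {f : X → Ξ → ℝ} {g : Ξ → ℝ} {π : X → ℝ}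
    (hf : ∀ x ξ, 0 < f x ξ) (hg : ∀ ξ, 0 < g ξ) (hg1 : ∑ ξ, g ξ = 1)
    (hunb : ∀ x, ∑ ξ, g ξ * f x ξ = π x) (hπ : ∀ x, 0 < π x) :
    1 - (∑ x, π x * weightMAD f g π x) / ∑ x, π x ≤
      mhAccept (proposal (perfectProposal π) g) (target f g) := by
  have hZ : 0 < ∑ z, π z := sum_pos (fun z _ => hπ z) univ_nonempty
  have hT : ∀ x y, 0 ≤ perfectProposal π x y := fun x y => div_nonneg (hπ y).le hZ.le
  have hTrow : ∀ x, ∑ y, perfectProposal π x y ≤ 1 := fun x => (sum_perfectProposal hπ x).le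
  have h := mhAccept_sub_pmAccept_le' hf hg hg1 hunb hπ hT hTrow
  rw [mhAccept_perfectProposal hπ] at h
  linarith

/-! ## Theorem 10 (a): the convex order of the weights orders the acceptance rates

[cite: AndrieuVihola2016, §2 Definition 3]: "The random variables `W₁ ∼ F₁` and `W₂ ∼ F₂` are convex
ordered, denoted `W₁ ≤cx W₂` … if for any convex function `φ : ℝ → ℝ`, `E[φ(W₁)] ≤ E[φ(W₂)]`".
[cite: AndrieuVihola2016, Theorem 10 (a)]: two pseudo-marginal approximations `P̃₁`, `P̃₂` of the
same marginal algorithm (same `π`, same proposal family) "with distinct weight distributions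
satisfying `{Q_x^{(1)}} ≤cx {Q_x^{(2)}}`" have conditional acceptance rates
`α_xy(P̃₁) ≥ α_xy(P̃₂)` for all `x, y` (§1: "It is possible to show directly that if for some `x, y`
the orders `Q_x^{(1)} ≤cx Q_x^{(2)}` and `Q_y^{(1)} ≤cx Q_y^{(2)}` hold, then
`α_xy(P̃₁) ≥ α_xy(P̃₂)`"; "If `Q_x^{(1)} ≤cx Q_x^{(2)}` for all `x`, then clearly
`α(P̃₁) ≥ α(P̃₂)`").  Finite form below: two positive estimators `f₁ : X → Ξ₁ → ℝ` (noise law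
`g₁`) and `f₂ : X → Ξ₂ → ℝ` (noise law `g₂`) of the same `π`; the proof is the elementary one —
`w ↦ min(A w, B u)` is concave for each fixed `u` and `u ↦ min(A w, B u)` for each fixed `w`, so the
convex order can be used one coordinate at a time on the product law `Q_x ⊗ Q_y`.  The marginal
algorithm is the case of the EXACT estimator (`Q_x ≡ δ_1`), which is below every unbiased
estimator in the convex order by Jensen's inequality [cite: AndrieuVihola2016, Remark 14 and
Theorem 37 (`δ_μ` minimises `E(W − t)₊` over all laws of mean `μ`)] — so `flow_le` (Lemma 1 of
the 2015 paper) is also the extreme case of Theorem 10 (a) (`flow_exact`, `isCxLE_exact`).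
-/

section ConvexOrder

variable {Ξ₁ Ξ₂ : Type*} [Fintype Ξ₁] [Fintype Ξ₂]

/-- **Convex order of two finitely supported weight laws** (values `w₁` with probabilities `g₁`
versus values `w₂` with probabilities `g₂`): `E φ(W₁) ≤ E φ(W₂)` for every convex `φ : ℝ → ℝ`.
[cite: AndrieuVihola2016, §2 Definition 3 (`W₁ ≤cx W₂`)] -/
def IsCxLE (g₁ : Ξ₁ → ℝ) (w₁ : Ξ₁ → ℝ) (g₂ : Ξ₂ → ℝ) (w₂ : Ξ₂ → ℝ) : Prop :=
  ∀ φ : ℝ → ℝ, ConvexOn ℝ Set.univ φ → ∑ ξ, g₁ ξ * φ (w₁ ξ) ≤ ∑ ξ, g₂ ξ * φ (w₂ ξ)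

/-- Convex order forces equal means (`x ↦ x` and `x ↦ −x` are convex).
[cite: AndrieuVihola2016, §2 Remark 4 ("the convex order `W₁ ≤cx W₂` clearly implies
`E[W₁] = E[W₂]`")] -/
theorem IsCxLE.sum_mul_eq {g₁ : Ξ₁ → ℝ} {w₁ : Ξ₁ → ℝ} {g₂ : Ξ₂ → ℝ} {w₂ : Ξ₂ → ℝ}
    (h : IsCxLE g₁ w₁ g₂ w₂) : ∑ ξ, g₁ ξ * w₁ ξ = ∑ ξ, g₂ ξ * w₂ ξ := by
  have h1 := h (fun t => t) ⟨convex_univ, fun x _ y _ a b _ _ _ => by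
    simp only [smul_eq_mul]; exact le_rfl⟩
  have h2 := h (fun t => -t) ⟨convex_univ, fun x _ y _ a b _ _ _ => by
    simp only [smul_eq_mul]; linarith⟩
  simp only [mul_neg, sum_neg_distrib, neg_le_neg_iff] at h2
  exact le_antisymm h1 h2

/-- `w ↦ −min(A·w, c)` is convex (a maximum of two affine functions), i.e. `w ↦ min(A·w, c)` is
concave (private helper). [folklore] -/
private theorem convexOn_neg_min_mul (A c : ℝ) :
    ConvexOn ℝ Set.univ (fun w : ℝ => -min (A * w) c) := by
  refine ⟨convex_univ, fun x _ y _ a b ha hb hab => ?_⟩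
  simp only [smul_eq_mul]
  have h1a := mul_le_mul_of_nonneg_left (min_le_left (A * x) c) ha
  have h1b := mul_le_mul_of_nonneg_left (min_le_left (A * y) c) hb
  have h2a := mul_le_mul_of_nonneg_left (min_le_right (A * x) c) ha
  have h2b := mul_le_mul_of_nonneg_left (min_le_right (A * y) c) hb
  have hlin : A * (a * x + b * y) = a * (A * x) + b * (A * y) := by ring
  have hc : c = a * c + b * c := by rw [← add_mul, hab, one_mul]
  have key : a * min (A * x) c + b * min (A * y) c ≤ min (A * (a * x + b * y)) c :=
    le_min (by rw [hlin]; exact add_le_add h1a h1b) ((add_le_add h2a h2b).trans hc.symm.le)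
  linarith

/-- `u ↦ −min(c, B·u)` is convex (private helper). [folklore] -/
private theorem convexOn_neg_min_mul_right (c B : ℝ) :
    ConvexOn ℝ Set.univ (fun u : ℝ => -min c (B * u)) := by
  have h := convexOn_neg_min_mul B c
  refine ⟨convex_univ, fun x hx y hy a b ha hb hab => ?_⟩
  have := h.2 hx hy ha hb hab
  simp only [smul_eq_mul] at this ⊢
  simpa only [min_comm] using this

omit [Fintype X] in
/-- The flow written with NORMALISED weights: `flow = Σ g ξ g ξ' min(A·w_ξ, B·u_ξ')` with
`A = π x T x y`, `B = π y T y x`, `w = f x ·/π x`, `u = f y ·/π y` (Andrieu–Vihola's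
`min{1, r u/w} Q_x(dw) w Q_y(du)` times `π x T x y`). [cite: AndrieuVihola2016, §1 (`α_xy(P̃)`)] -/
theorem flow_eq_norm {f : X → Ξ → ℝ} {g : Ξ → ℝ} {π : X → ℝ} (hf : ∀ x ξ, 0 < f x ξ)
    (hg : ∀ ξ, 0 < g ξ) (hπ : ∀ x, 0 < π x) (T : X → X → ℝ) (x y : X) :
    flow T f g x y = ∑ ξ, ∑ ξ', g ξ * g ξ' *
      min (π x * T x y * (f x ξ / π x)) (π y * T y x * (f y ξ' / π y)) := by
  rw [flow_eq hf hg]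
  have hx : π x ≠ 0 := (hπ x).ne'
  have hy : π y ≠ 0 := (hπ y).ne'
  refine sum_congr rfl fun ξ _ => sum_congr rfl fun ξ' _ => ?_
  rw [show π x * T x y * (f x ξ / π x) = f x ξ * T x y by field_simp,
    show π y * T y x * (f y ξ' / π y) = f y ξ' * T y x by field_simp]

/-- One coordinate of the comparison: if the normalised weights at `x` are convex-ordered,
`W¹_x ≤cx W²_x`, then for every fixed fresh weight `u` the `x`-average of `min(A·w, B·u)` is larger
under law 1 (concavity of `w ↦ min(A w, B u)`; private helper).
[cite: AndrieuVihola2016, Theorem 10 (a) (proof via Theorem 19 (a))] -/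
private theorem sum_min_mono_left {g₁ : Ξ₁ → ℝ} {w₁ : Ξ₁ → ℝ} {g₂ : Ξ₂ → ℝ} {w₂ : Ξ₂ → ℝ}
    (h : IsCxLE g₁ w₁ g₂ w₂) (A B u : ℝ) :
    ∑ ξ, g₂ ξ * min (A * w₂ ξ) (B * u) ≤ ∑ ξ, g₁ ξ * min (A * w₁ ξ) (B * u) := by
  have := h _ (convexOn_neg_min_mul A (B * u))
  simp only [mul_neg, sum_neg_distrib, neg_le_neg_iff] at this
  exact this

/-- The other coordinate (private helper). [cite: AndrieuVihola2016, Theorem 10 (a)] -/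
private theorem sum_min_mono_right {g₁ : Ξ₁ → ℝ} {u₁ : Ξ₁ → ℝ} {g₂ : Ξ₂ → ℝ} {u₂ : Ξ₂ → ℝ}
    (h : IsCxLE g₁ u₁ g₂ u₂) (A B w : ℝ) :
    ∑ ξ', g₂ ξ' * min (A * w) (B * u₂ ξ') ≤ ∑ ξ', g₁ ξ' * min (A * w) (B * u₁ ξ') := by
  have := h _ (convexOn_neg_min_mul_right (A * w) B)
  simp only [mul_neg, sum_neg_distrib, neg_le_neg_iff] at this
  exact this

omit [Fintype X] in
/-- **Andrieu–Vihola 2016, Theorem 10 (a)** (finite form): for two pseudo-marginal algorithms with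
the same proposal matrix `T` and the same target `π` whose normalised weight laws satisfy
`Q_x^{(1)} ≤cx Q_x^{(2)}` and `Q_y^{(1)} ≤cx Q_y^{(2)}`, the stationary `x → y` acceptance flows
satisfy `flow(P̃₂) ≤ flow(P̃₁)` — "the conditional acceptance rates satisfy
`α_xy(P̃₁) ≥ α_xy(P̃₂)`": LESS VARIABLE weights (in the convex order) accept MORE.
[cite: AndrieuVihola2016, Theorem 10 (a) and §1 ("if for some `x, y ∈ X` the orders
`Q_x^{(1)} ≤cx Q_x^{(2)}` and `Q_y^{(1)} ≤cx Q_y^{(2)}` hold, then `α_xy(P̃₁) ≥ α_xy(P̃₂)`")] -/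
theorem flow_mono_of_isCxLE {f₁ : X → Ξ₁ → ℝ} {g₁ : Ξ₁ → ℝ} {f₂ : X → Ξ₂ → ℝ} {g₂ : Ξ₂ → ℝ}
    {π : X → ℝ} (hf₁ : ∀ x ξ, 0 < f₁ x ξ) (hg₁ : ∀ ξ, 0 < g₁ ξ) (hf₂ : ∀ x ξ, 0 < f₂ x ξ)
    (hg₂ : ∀ ξ, 0 < g₂ ξ) (hπ : ∀ x, 0 < π x) (T : X → X → ℝ) {x y : X}
    (hx : IsCxLE g₁ (fun ξ => f₁ x ξ / π x) g₂ (fun ξ => f₂ x ξ / π x))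
    (hy : IsCxLE g₁ (fun ξ => f₁ y ξ / π y) g₂ (fun ξ => f₂ y ξ / π y)) :
    flow T f₂ g₂ x y ≤ flow T f₁ g₁ x y := by
  rw [flow_eq_norm hf₁ hg₁ hπ, flow_eq_norm hf₂ hg₂ hπ]
  set A : ℝ := π x * T x y
  set B : ℝ := π y * T y x
  -- step 1: replace the recycled weight law at `x` (inner sums over `ξ`, for each fresh `ξ'`)
  have step1 : ∑ ξ, ∑ ξ', g₂ ξ * g₂ ξ' * min (A * (f₂ x ξ / π x)) (B * (f₂ y ξ' / π y)) ≤
      ∑ ξ, ∑ ξ', g₁ ξ * g₂ ξ' * min (A * (f₁ x ξ / π x)) (B * (f₂ y ξ' / π y)) := by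
    conv_lhs => rw [sum_comm]
    conv_rhs => rw [sum_comm]
    refine sum_le_sum fun ξ' _ => ?_
    calc ∑ ξ, g₂ ξ * g₂ ξ' * min (A * (f₂ x ξ / π x)) (B * (f₂ y ξ' / π y))
        = g₂ ξ' * ∑ ξ, g₂ ξ * min (A * (f₂ x ξ / π x)) (B * (f₂ y ξ' / π y)) := by
          rw [mul_sum]; exact sum_congr rfl fun ξ _ => by ring
      _ ≤ g₂ ξ' * ∑ ξ, g₁ ξ * min (A * (f₁ x ξ / π x)) (B * (f₂ y ξ' / π y)) :=
          mul_le_mul_of_nonneg_left (sum_min_mono_left hx A B (f₂ y ξ' / π y)) (hg₂ ξ').le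
      _ = ∑ ξ, g₁ ξ * g₂ ξ' * min (A * (f₁ x ξ / π x)) (B * (f₂ y ξ' / π y)) := by
          rw [mul_sum]; exact sum_congr rfl fun ξ _ => by ring
  -- step 2: replace the fresh weight law at `y` (inner sums over `ξ'`, for each recycled `ξ`)
  have step2 : ∑ ξ, ∑ ξ', g₁ ξ * g₂ ξ' * min (A * (f₁ x ξ / π x)) (B * (f₂ y ξ' / π y)) ≤
      ∑ ξ, ∑ ξ', g₁ ξ * g₁ ξ' * min (A * (f₁ x ξ / π x)) (B * (f₁ y ξ' / π y)) := by
    refine sum_le_sum fun ξ _ => ?_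
    calc ∑ ξ', g₁ ξ * g₂ ξ' * min (A * (f₁ x ξ / π x)) (B * (f₂ y ξ' / π y))
        = g₁ ξ * ∑ ξ', g₂ ξ' * min (A * (f₁ x ξ / π x)) (B * (f₂ y ξ' / π y)) := by
          rw [mul_sum]; exact sum_congr rfl fun ξ' _ => by ring
      _ ≤ g₁ ξ * ∑ ξ', g₁ ξ' * min (A * (f₁ x ξ / π x)) (B * (f₁ y ξ' / π y)) :=
          mul_le_mul_of_nonneg_left (sum_min_mono_right hy A B (f₁ x ξ / π x)) (hg₁ ξ).le
      _ = ∑ ξ', g₁ ξ * g₁ ξ' * min (A * (f₁ x ξ / π x)) (B * (f₁ y ξ' / π y)) := by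
          rw [mul_sum]; exact sum_congr rfl fun ξ' _ => by ring
  exact step1.trans step2

/-- **Theorem 10 (a), summed**: if `Q_x^{(1)} ≤cx Q_x^{(2)}` for EVERY state `x`, the stationary
expected acceptance rates satisfy `α(P̃₂) ≤ α(P̃₁)` — "If `Q_x^{(1)} ≤cx Q_x^{(2)}` for all `x ∈ X`,
then clearly `α(P̃₁) ≥ α(P̃₂)`".  (Both estimators must be unbiased for the same `π`, as the
convex order itself forces: `IsCxLE.sum_mul_eq`.) [cite: AndrieuVihola2016, Theorem 10 (a) and
§1 (the sentence on `α(P̃₁) ≥ α(P̃₂)`)] -/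
theorem pmAccept_mono_of_isCxLE {f₁ : X → Ξ₁ → ℝ} {g₁ : Ξ₁ → ℝ} {f₂ : X → Ξ₂ → ℝ}
    {g₂ : Ξ₂ → ℝ} {π : X → ℝ} (hf₁ : ∀ x ξ, 0 < f₁ x ξ) (hg₁ : ∀ ξ, 0 < g₁ ξ)
    (hf₂ : ∀ x ξ, 0 < f₂ x ξ) (hg₂ : ∀ ξ, 0 < g₂ ξ) (hπ : ∀ x, 0 < π x)
    (hunb₁ : ∀ x, ∑ ξ, g₁ ξ * f₁ x ξ = π x) (hunb₂ : ∀ x, ∑ ξ, g₂ ξ * f₂ x ξ = π x)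
    (hcx : ∀ x, IsCxLE g₁ (fun ξ => f₁ x ξ / π x) g₂ (fun ξ => f₂ x ξ / π x))
    (T : X → X → ℝ) :
    mhAccept (proposal T g₂) (target f₂ g₂) ≤ mhAccept (proposal T g₁) (target f₁ g₁) := by
  rw [pmAccept_eq hunb₁, pmAccept_eq hunb₂]
  exact div_le_div_of_nonneg_right (sum_le_sum fun x _ => sum_le_sum fun y _ =>
    flow_mono_of_isCxLE hf₁ hg₁ hf₂ hg₂ hπ T (hcx x) (hcx y)) (sum_nonneg fun x _ => (hπ x).le)

/-- **The exact estimator is minimal in the convex order** (Jensen): the constant weight `1` (the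
marginal algorithm, `Q_x ≡ δ_1`) satisfies `δ_1 ≤cx Q_x` for every finitely supported law `Q_x` of
mean `1` — "`δ_1` is the unique minimal distribution in the convex order".
[cite: AndrieuVihola2016, Remark 14 and Theorem 37] -/
theorem isCxLE_exact {g₁ : Ξ₁ → ℝ} (hg₁ : ∑ ξ, g₁ ξ = 1) {g₂ : Ξ₂ → ℝ}
    {w₂ : Ξ₂ → ℝ} (hg₂ : ∀ ξ, 0 ≤ g₂ ξ) (hg₂1 : ∑ ξ, g₂ ξ = 1) (hmean : ∑ ξ, g₂ ξ * w₂ ξ = 1) :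
    IsCxLE g₁ (fun _ => (1 : ℝ)) g₂ w₂ := by
  intro φ hφ
  have hJ := hφ.map_sum_le (t := univ) (w := g₂) (p := w₂) (fun ξ _ => hg₂ ξ) hg₂1
    (fun ξ _ => Set.mem_univ _)
  simp only [smul_eq_mul] at hJ
  rw [hmean] at hJ
  calc ∑ ξ, g₁ ξ * φ 1 = φ 1 := by rw [← sum_mul, hg₁, one_mul]
    _ ≤ ∑ ξ, g₂ ξ * φ (w₂ ξ) := hJ

omit [Fintype X] in
/-- The flow of the EXACT estimator (`f x ξ = π x` for all `ξ`) is the marginal chain's flow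
`min(π x T x y, π y T y x)`: the marginal algorithm as the pseudo-marginal algorithm with
`Q_x ≡ δ_1`. [cite: AndrieuVihola2016, Remark 14 ("the marginal algorithm, or equivalently, …
the degenerate case `Q_x^{(1)} ≡ δ_1`")] -/
theorem flow_exact {g : Ξ → ℝ} {π : X → ℝ} (hg : ∀ ξ, 0 < g ξ) (hg1 : ∑ ξ, g ξ = 1)
    (hπ : ∀ x, 0 < π x) (T : X → X → ℝ) (x y : X) :
    flow T (fun z _ => π z) g x y = min (π x * T x y) (π y * T y x) := by
  rw [flow_eq (fun z _ => hπ z) hg]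
  have : ∀ ξ ξ', g ξ * g ξ' * min (π x * T x y) (π y * T y x) =
      g ξ * min (π x * T x y) (π y * T y x) * g ξ' := fun ξ ξ' => by ring
  simp_rw [this, ← mul_sum, hg1, mul_one, ← sum_mul, hg1, one_mul]

omit [Fintype X] in
/-- **Lemma 1 as the extreme case of Theorem 10 (a)**: comparing any unbiased estimator with the
exact one (`δ_1 ≤cx Q_x` by `isCxLE_exact`) in `flow_mono_of_isCxLE` gives back `flow_le`.
[cite: AndrieuVihola2016, Remark 14 ("Theorem 10 (a)–(c) generalise the findings in [AV2015]
which state similar bounds in the special case where `P̃₁` corresponds to the marginal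
algorithm")]; [cite: AndrieuVihola2015, §2 Lemma 1] -/
theorem flow_le_of_isCxLE {f : X → Ξ → ℝ} {g : Ξ → ℝ} {π : X → ℝ} (hf : ∀ x ξ, 0 < f x ξ)
    (hg : ∀ ξ, 0 < g ξ) (hg1 : ∑ ξ, g ξ = 1) (hunb : ∀ x, ∑ ξ, g ξ * f x ξ = π x)
    (hπ : ∀ x, 0 < π x) (T : X → X → ℝ) (x y : X) :
    flow T f g x y ≤ min (π x * T x y) (π y * T y x) := by
  rw [← flow_exact hg hg1 hπ T x y]
  have hcx : ∀ z, IsCxLE g (fun _ : Ξ => π z / π z) g (fun ξ => f z ξ / π z) := by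
    intro z
    rw [show (fun _ : Ξ => π z / π z) = fun _ => (1 : ℝ) from funext fun _ => div_self (hπ z).ne']
    exact isCxLE_exact hg1 (fun ξ => (hg ξ).le) hg1 (sum_normWeight hunb hπ z)
  exact flow_mono_of_isCxLE (f₁ := fun z _ => π z) (g₁ := g) (f₂ := f) (g₂ := g)
    (fun z _ => hπ z) hg hf hg hπ T (hcx x) (hcx y)

end ConvexOrder

/-! ## Theorem 31 (acceptance half): every extra pseudofermion draw raises the acceptance rate

[cite: AndrieuVihola2016, §6.1]: "A simple and practical way to reduce variability of an estimator
is to average multiple independent realisations of this estimator … One may wonder whether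
averaging always improves performance of a pseudo-marginal algorithm … the answer to this question
is positive, and a direct consequence of the convex order"; Theorem 28 (majorised weights of
exchangeable copies are convex-ordered, after Shaked–Shanthikumar) and Theorem 31 ("the optimal
weighting of `N` estimators is the uniform weighting, and that every extra sample improves
performance": `α_xy(P̃_{u_N})` is non-decreasing in `N`).  Below: the special case of INDEPENDENT
copies and uniform weights `u_{N+1} ≺ u_N`, which is the lattice one — the multi-draw pseudofermion
weight `w_{N_pf} = (1/N_pf) Σ_k w(φ_k | U)` of [cite: AbbottEtAl2022Fermions, §III.E (multiple
pseudofermion draws; `ESS(N_pf)`)] — proved by the leave-one-out symmetrisation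
`W̄_{N+1} = (1/(N+1)) Σ_j W̄_N^{(−j)}` and Jensen; together with Theorem 10 (a) it gives the
ACCEPTANCE analogue of the monotonicity of `ESS(N_pf)` (`Literature.Probability.ImportanceSampling.
essInvNpf_antitone`).
-/

section Averaging

/-- The product law of `N` independent draws from `g` (the `N_pf` pseudofermion draws).
[cite: AbbottEtAl2022Fermions, §III.E (independent pseudofermion draws `φ_k ∼ q(φ|U)`)];
[cite: AndrieuVihola2016, §6.1 ("`N` independent and identical realisations of an estimator")] -/
def piLaw (g : Ξ → ℝ) (N : ℕ) : (Fin N → Ξ) → ℝ := fun ζ => ∏ i, g (ζ i)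

/-- The uniformly AVERAGED estimator over `N` draws, `(1/N) Σ_i f x ζ_i` (the weight `u_N` of
Andrieu–Vihola; the multi-draw pseudofermion weight `w_{N_pf}`).
[cite: AbbottEtAl2022Fermions, §III.E (`w_{N_pf}`)]; [cite: AndrieuVihola2016, §6.1 (uniform weights
`u_k = (1/k, …, 1/k, 0, …, 0)`)] -/
noncomputable def avgEst (f : X → Ξ → ℝ) (N : ℕ) : X → (Fin N → Ξ) → ℝ :=
  fun x ζ => (∑ i, f x (ζ i)) / N

omit [Fintype Ξ] in
/-- The uniform average of the values `w` over an `N`-tuple of draws (private helper). [folklore] -/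
private noncomputable def avgW (w : Ξ → ℝ) (N : ℕ) : (Fin N → Ξ) → ℝ := fun ζ => (∑ i, w (ζ i)) / N

omit [Fintype X] [Fintype Ξ] in
/-- The normalised averaged estimator is the average of the normalised weights. [folklore] -/
private theorem avgEst_div (f : X → Ξ → ℝ) (π : X → ℝ) (N : ℕ) (x : X) (ζ : Fin N → Ξ) :
    avgEst f N x ζ / π x = avgW (fun ξ => f x ξ / π x) N ζ := by
  simp only [avgEst, avgW, sum_div]
  exact sum_congr rfl fun i _ => div_right_comm _ _ _

omit [Fintype Ξ] in
/-- The product law is positive when `g` is. [folklore] -/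
private theorem piLaw_pos {g : Ξ → ℝ} (hg : ∀ ξ, 0 < g ξ) (N : ℕ) (ζ : Fin N → Ξ) :
    0 < piLaw g N ζ :=
  prod_pos fun i _ => hg (ζ i)

omit [Fintype X] [Fintype Ξ] in
/-- The averaged estimator over at least one draw is positive when `f` is. [folklore] -/
private theorem avgEst_pos {f : X → Ξ → ℝ} (hf : ∀ x ξ, 0 < f x ξ) (N : ℕ) [NeZero N] (x : X)
    (ζ : Fin N → Ξ) : 0 < avgEst f N x ζ :=
  div_pos (sum_pos (fun i _ => hf x (ζ i)) univ_nonempty) (Nat.cast_pos.mpr (Nat.pos_of_neZero N))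

/-- Total mass of the product law: `Σ_ζ Π_i g(ζ_i) = (Σ g)^N`.
[cite: AndrieuVihola2016, §6.1 (independent realisations)] -/
theorem sum_piLaw (g : Ξ → ℝ) (N : ℕ) : ∑ ζ, piLaw g N ζ = (∑ a, g a) ^ N := by
  classical
  rw [sum_pow', Fintype.piFinset_univ]
  rfl

/-- Re-indexing a sum over `(N+1)`-tuples by separating out the `j`-th draw (private helper).
[folklore] -/
private theorem sum_tuple_insertNth {M : Type*} [AddCommMonoid M] {N : ℕ} (j : Fin (N + 1))
    (H : (Fin (N + 1) → Ξ) → M) :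
    ∑ ζ, H ζ = ∑ a, ∑ ζ' : Fin N → Ξ, H (Fin.insertNth j a ζ') := by
  rw [← Fintype.sum_prod_type']
  exact (Fintype.sum_equiv (Fin.insertNthEquiv (fun _ => Ξ) j) _ _ fun q => rfl).symm

omit [Fintype Ξ] in
/-- The product law factorises over the separated draw (private helper). [folklore] -/
private theorem piLaw_insertNth (g : Ξ → ℝ) {N : ℕ} (j : Fin (N + 1)) (a : Ξ)
    (ζ' : Fin N → Ξ) : piLaw g (N + 1) (Fin.insertNth j a ζ') = g a * piLaw g N ζ' := by
  simp only [piLaw]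
  rw [Fin.prod_univ_succAbove _ j, Fin.insertNth_apply_same]
  congr 1
  exact prod_congr rfl fun i _ => by rw [Fin.insertNth_apply_succAbove]

/-- Marginalising the separated draw: for a function of the REMAINING draws,
`Σ_ζ Π g(ζ_i) · F(ζ without j) = (Σ g) · Σ_{ζ'} Π g(ζ'_i) · F(ζ')` (private helper). [folklore] -/
private theorem sum_piLaw_mul_removeNth (g : Ξ → ℝ) {N : ℕ} (j : Fin (N + 1))
    (F : (Fin N → Ξ) → ℝ) :
    ∑ ζ, piLaw g (N + 1) ζ * F (Fin.removeNth j ζ) =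
      (∑ a, g a) * ∑ ζ' : Fin N → Ξ, piLaw g N ζ' * F ζ' := by
  rw [sum_tuple_insertNth j, sum_mul]
  refine sum_congr rfl fun a _ => ?_
  rw [mul_sum]
  refine sum_congr rfl fun ζ' _ => ?_
  rw [piLaw_insertNth, Fin.removeNth_insertNth, mul_assoc]

omit [Fintype X] in
/-- **The averaged estimator is unbiased** (`Σ g = 1`): `Σ_ζ Π g(ζ_i) · (1/N) Σ_i f x ζ_i = π x` for
`N ≥ 1` draws. [cite: AbbottEtAl2022Fermions, §III.E (`w_{N_pf}` is an unbiased positive estimator of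
the reweighting factor)]; [cite: AndrieuVihola2016, §6.1 (the averaged weights "are non-negative and
have unit expectation")] -/
theorem sum_piLaw_mul_avgEst {f : X → Ξ → ℝ} {g : Ξ → ℝ} {π : X → ℝ} (hg1 : ∑ ξ, g ξ = 1)
    (hunb : ∀ x, ∑ ξ, g ξ * f x ξ = π x) (N : ℕ) [NeZero N] (x : X) :
    ∑ ζ, piLaw g N ζ * avgEst f N x ζ = π x := by
  obtain ⟨M, rfl⟩ := Nat.exists_eq_succ_of_ne_zero (NeZero.ne N)
  have hcoord : ∀ i : Fin (M + 1), ∑ ζ, piLaw g (M + 1) ζ * f x (ζ i) = π x := by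
    intro i
    rw [sum_tuple_insertNth i]
    have : ∀ a (ζ' : Fin M → Ξ), piLaw g (M + 1) (Fin.insertNth i a ζ') *
        f x ((Fin.insertNth i a ζ' : Fin (M + 1) → Ξ) i) = g a * f x a * piLaw g M ζ' := by
      intro a ζ'
      rw [piLaw_insertNth, Fin.insertNth_apply_same]
      ring
    simp_rw [this, ← mul_sum, sum_piLaw, hg1, one_pow, mul_one]
    exact hunb x
  have hM : ((M + 1 : ℕ) : ℝ) ≠ 0 := Nat.cast_ne_zero.mpr (Nat.succ_ne_zero M)
  simp only [avgEst]
  simp_rw [mul_div_assoc', mul_sum, ← sum_div]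
  rw [sum_comm]
  simp_rw [hcoord, sum_const, card_univ, Fintype.card_fin, nsmul_eq_mul]
  exact mul_div_cancel_left₀ _ hM

omit [Fintype Ξ] in
/-- The leave-one-out identity behind the symmetrisation: summing, over the left-out index `j`, the
sums of the remaining `M+1` values of an `(M+2)`-tuple gives `(M+1)` times the full sum
(private helper). [folklore] -/
private theorem sum_sum_succAbove {M : ℕ} (v : Fin (M + 2) → ℝ) :
    ∑ j : Fin (M + 2), ∑ i : Fin (M + 1), v (j.succAbove i) = (M + 1) * ∑ k, v k := by
  have h : ∀ j : Fin (M + 2), ∑ i : Fin (M + 1), v (j.succAbove i) = ∑ k, v k - v j := by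
    intro j
    rw [Fin.sum_univ_succAbove v j]
    ring
  simp_rw [h, sum_sub_distrib, sum_const, card_univ, Fintype.card_fin, nsmul_eq_mul]
  push_cast
  ring

omit [Fintype Ξ] in
/-- The uniform average over `M+2` draws is the uniform average, over the left-out index, of the
`M+1`-draw averages: `W̄_{M+2} = (1/(M+2)) Σ_j W̄_{M+1}^{(−j)}` (private helper). [folklore] -/
private theorem avgW_succ_eq (w : Ξ → ℝ) (M : ℕ) (ζ : Fin (M + 2) → Ξ) :
    avgW w (M + 2) ζ =
      ∑ j : Fin (M + 2), (1 / ((M + 2 : ℕ) : ℝ)) * avgW w (M + 1) (Fin.removeNth j ζ) := by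
  have h2 : ∑ j : Fin (M + 2), ∑ i : Fin (M + 1), w (ζ (j.succAbove i)) = (M + 1) * ∑ k, w (ζ k) :=
    sum_sum_succAbove fun k => w (ζ k)
  have hM1 : ((M + 1 : ℕ) : ℝ) ≠ 0 := Nat.cast_ne_zero.mpr (Nat.succ_ne_zero M)
  have hM2 : ((M + 2 : ℕ) : ℝ) ≠ 0 := Nat.cast_ne_zero.mpr (Nat.succ_ne_zero (M + 1))
  simp only [avgW, Fin.removeNth]
  rw [← mul_sum, ← sum_div, h2]
  push_cast at hM1 hM2 ⊢
  field_simp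

/-- **Averaging one more independent draw decreases the weight in the convex order**:
`(1/(M+2)) Σ_{i ≤ M+2} W_i ≤cx (1/(M+1)) Σ_{i ≤ M+1} W_i` for i.i.d. draws — the case `u_{k+1} ≺ u_k`
of "`(λ, Z) ≤cx (μ, Z)` for `λ ≺ μ`".  Proof: `W̄_{M+2} = (1/(M+2)) Σ_j W̄_{M+1}^{(−j)}`, Jensen, and
each leave-one-out average has the law of `W̄_{M+1}`. [cite: AndrieuVihola2016, §6.1 Theorem 28
(after Shaked–Shanthikumar) and Theorem 31 ("every extra sample improves performance")] -/
theorem isCxLE_avg_succ {g : Ξ → ℝ} (hg : ∀ ξ, 0 ≤ g ξ) (hg1 : ∑ ξ, g ξ = 1) (w : Ξ → ℝ) (M : ℕ) :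
    IsCxLE (piLaw g (M + 2)) (fun ζ => (∑ i, w (ζ i)) / (M + 2 : ℕ))
      (piLaw g (M + 1)) (fun ζ => (∑ i, w (ζ i)) / (M + 1 : ℕ)) := by
  intro φ hφ
  have hpi : ∀ N (ζ : Fin N → Ξ), 0 ≤ piLaw g N ζ := fun N ζ => prod_nonneg fun i _ => hg (ζ i)
  have hM2 : ((M + 2 : ℕ) : ℝ) ≠ 0 := Nat.cast_ne_zero.mpr (Nat.succ_ne_zero (M + 1))
  set c : ℝ := 1 / ((M + 2 : ℕ) : ℝ) with hc
  -- Jensen along the leave-one-out decomposition, tuple by tuple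
  have hJ : ∀ ζ : Fin (M + 2) → Ξ, φ (avgW w (M + 2) ζ) ≤
      ∑ j : Fin (M + 2), c * φ (avgW w (M + 1) (Fin.removeNth j ζ)) := by
    intro ζ
    have hw1 : ∑ _j : Fin (M + 2), c = 1 := by
      rw [sum_const, card_univ, Fintype.card_fin, nsmul_eq_mul, hc, mul_one_div_cancel hM2]
    have h := hφ.map_sum_le (t := univ) (w := fun _ : Fin (M + 2) => c)
      (p := fun j => avgW w (M + 1) (Fin.removeNth j ζ))
      (fun _ _ => by rw [hc]; positivity) hw1 (fun _ _ => Set.mem_univ _)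
    simp only [smul_eq_mul] at h
    rw [← avgW_succ_eq w M ζ] at h
    exact h
  calc ∑ ζ, piLaw g (M + 2) ζ * φ ((∑ i, w (ζ i)) / (M + 2 : ℕ))
      = ∑ ζ, piLaw g (M + 2) ζ * φ (avgW w (M + 2) ζ) := rfl
    _ ≤ ∑ ζ, piLaw g (M + 2) ζ * ∑ j : Fin (M + 2), c * φ (avgW w (M + 1) (Fin.removeNth j ζ)) :=
        sum_le_sum fun ζ _ => mul_le_mul_of_nonneg_left (hJ ζ) (hpi _ ζ)
    _ = c * ∑ j : Fin (M + 2), ∑ ζ, piLaw g (M + 2) ζ * φ (avgW w (M + 1) (Fin.removeNth j ζ)) := by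
        rw [mul_sum]
        simp_rw [mul_sum]
        rw [sum_comm]
        exact sum_congr rfl fun j _ => sum_congr rfl fun ζ _ => by ring
    _ = c * ∑ _j : Fin (M + 2), ∑ ζ', piLaw g (M + 1) ζ' * φ (avgW w (M + 1) ζ') := by
        congr 1
        refine sum_congr rfl fun j _ => ?_
        rw [sum_piLaw_mul_removeNth g j (fun ζ' => φ (avgW w (M + 1) ζ')), hg1, one_mul]
    _ = ∑ ζ', piLaw g (M + 1) ζ' * φ (avgW w (M + 1) ζ') := by
        rw [sum_const, card_univ, Fintype.card_fin, nsmul_eq_mul, ← mul_assoc, hc,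
          one_div_mul_cancel hM2, one_mul]
    _ = ∑ ζ, piLaw g (M + 1) ζ * φ ((∑ i, w (ζ i)) / (M + 1 : ℕ)) := rfl

/-- **Every extra pseudofermion draw raises the acceptance rate** (Theorem 31, acceptance half, for
independent draws): with the same proposal matrix `T` and the same per-draw estimator `f`, the
pseudo-marginal chain using the `(M+2)`-draw average `w_{M+2}` accepts at least as often, at
stationarity, as the one using `w_{M+1}`.  [cite: AndrieuVihola2016, §6.1 Theorem 31 ("every extra
sample improves performance"; `N ↦ α_xy(P̃_{u_N})` non-decreasing) with Theorem 10 (a)];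
[cite: AbbottEtAl2022Fermions, §III.E (the `N_pf`-draw weight `w_{N_pf}`)] -/
theorem pmAccept_avgEst_mono {f : X → Ξ → ℝ} {g : Ξ → ℝ} {π : X → ℝ} (hf : ∀ x ξ, 0 < f x ξ)
    (hg : ∀ ξ, 0 < g ξ) (hg1 : ∑ ξ, g ξ = 1) (hunb : ∀ x, ∑ ξ, g ξ * f x ξ = π x)
    (hπ : ∀ x, 0 < π x) (T : X → X → ℝ) (M : ℕ) :
    mhAccept (proposal T (piLaw g (M + 1))) (target (avgEst f (M + 1)) (piLaw g (M + 1))) ≤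
      mhAccept (proposal T (piLaw g (M + 2))) (target (avgEst f (M + 2)) (piLaw g (M + 2))) := by
  refine pmAccept_mono_of_isCxLE (fun x ζ => avgEst_pos hf (M + 2) x ζ) (piLaw_pos hg (M + 2))
    (fun x ζ => avgEst_pos hf (M + 1) x ζ) (piLaw_pos hg (M + 1)) hπ
    (sum_piLaw_mul_avgEst hg1 hunb (M + 2)) (sum_piLaw_mul_avgEst hg1 hunb (M + 1)) (fun x => ?_) T
  have h := isCxLE_avg_succ (fun ξ => (hg ξ).le) hg1 (fun ξ => f x ξ / π x) M
  have e : ∀ N : ℕ, (fun ζ : Fin N → Ξ => avgEst f N x ζ / π x) =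
      fun ζ => (∑ i, f x (ζ i) / π x) / (N : ℕ) := by
    intro N
    funext ζ
    rw [avgEst_div]
    rfl
  rw [e (M + 2), e (M + 1)]
  exact h

end Averaging

end PseudoMarginal

end Literature.Probability.MarkovChains
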